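import Summits.CriticalPhenomena.SAWScalingLimit.Theorems.SAWDefectDecoherenceBoundaryClosureRInnerPolygonsHalfLattice
import Summits.CriticalPhenomena.SAWScalingLimit.Theorems.SAWDefectDecoherenceBoundaryClosureRIdentificationGateHopf
import HarnessLib

/-!
# Crux `BoundaryClosureR` (stmt-CriticalPhenomena-14004), line `polygon-parity-squeeze`,
# stub `boundaryPhaseBookkeeping` (piece D of the (A) assembly): plane geometry of the six
# zigzag half-planes — forms are determined by the local set, flat balls, corner balls

Elementary geometry used by the boundary phase bookkeeping (the product
`κ · n_k · e^{i(3/8)α}` is constant along `∂Ω ∖ {a}`):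

* the six inner normals in coordinates `n_k = (√3 x_k + i y_k)/2`, `x = (0,0,1,-1,1,-1)`,
  `y = (2,-2,-1,1,1,-1)`, so that `Re(n_j conj n_k) = (3 x_j x_k + y_j y_k)/4` and every
  question "which of the six test points `z + (s/2) n_j` lies in a given zigzag half-plane / convex
  corner / reflex corner through `z`" is a DECIDABLE statement about `Fin 6`;
* consequences (`decide`): the form `k` of a flat ball `Ω ∩ B = halfPlane k z ∩ B` is unique
  (`form_unique`), the unordered pair of forms of a genuine corner ball is unique whatever the
  presentation (`corner_forms_unique`), a flat ball has only trivial corner presentations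
  (`corner_forms_of_flat`), the normals are injective and `n_{k'} = -n_k` only for opposite forms;
* flat balls: frontier points lie on the side line, side-line points are frontier points, sub-balls
  about side-line points are flat with the same form;
* genuine corner balls (`n_{k'} ≠ ± n_k`, `Ω ∩ B = (H_k ∩ H_{k'}) ∩ B` or `(H_k ∪ H_{k'}) ∩ B`):
  frontier points lie on one of the two side lines, side-line points other than the apex are
  flat points of the expected form, such points exist arbitrarily close to the apex, and the
  corner ball is preconnected.

All statements are folklore plane geometry; no proposition is defined.
-/

noncomputable section

open scoped ComplexConjugate Topology
open Set Metric Filter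

namespace Summit.CriticalPhenomena.SAWScalingLimit.Theorems.PolygonParitySqueeze

namespace PhaseGeometry


/-! ### 1. The six normals in coordinates; test points -/

/-- **The six inner normals in coordinates**: `n_k = (√3/2) x_k + (i/2) y_k`. [folklore] -/
theorem innerNormal_table (k : Fin 6) :
    innerNormal k = ⟨Real.sqrt 3 / 2 * (((![0, 0, 1, -1, 1, -1] : Fin 6 → ℤ) k : ℤ) : ℝ), 1 / 2 * (((![2, -2, -1, 1, 1, -1] : Fin 6 → ℤ) k : ℤ) : ℝ)⟩ := by
  fin_cases k <;> apply Complex.ext <;> simp [innerNormal_eq]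

/-- The signed level in coordinates: `Re(v conj n_k) = (√3/2) x_k Re v + (1/2) y_k Im v`.
[folklore] -/
theorem level_eq (k : Fin 6) (v : ℂ) : (v * conj (innerNormal k)).re =
    Real.sqrt 3 / 2 * (((![0, 0, 1, -1, 1, -1] : Fin 6 → ℤ) k : ℤ) : ℝ) * v.re + 1 / 2 * (((![2, -2, -1, 1, 1, -1] : Fin 6 → ℤ) k : ℤ) : ℝ) * v.im := by
  rw [innerNormal_table k, Complex.mul_re, Complex.conj_re, Complex.conj_im]
  ring

/-- **Gram table of the normals**: `Re(n_j conj n_k) = (3 x_j x_k + y_j y_k)/4`. [folklore] -/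
theorem re_mul_conj_innerNormal (j k : Fin 6) :
    (innerNormal j * conj (innerNormal k)).re = ((3 * (![0, 0, 1, -1, 1, -1] : Fin 6 → ℤ) j * (![0, 0, 1, -1, 1, -1] : Fin 6 → ℤ) k + (![2, -2, -1, 1, 1, -1] : Fin 6 → ℤ) j * (![2, -2, -1, 1, 1, -1] : Fin 6 → ℤ) k : ℤ) : ℝ) / 4 := by
  rw [level_eq k, innerNormal_table j]
  have h3 : Real.sqrt 3 * Real.sqrt 3 = 3 := Real.mul_self_sqrt (by norm_num)
  push_cast
  linear_combination ((((![0, 0, 1, -1, 1, -1] : Fin 6 → ℤ) j : ℤ) : ℝ) * (((![0, 0, 1, -1, 1, -1] : Fin 6 → ℤ) k : ℤ) : ℝ) / 4) * h3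

/-- The test point `z + (s/2) n_j` lies in `B(z, s)`. [folklore] -/
theorem testPoint_mem_ball (z : ℂ) {s : ℝ} (hs : 0 < s) (j : Fin 6) :
    z + ((s / 2 : ℝ) : ℂ) * innerNormal j ∈ ball z s := by
  rw [mem_ball, dist_eq_norm, add_sub_cancel_left, norm_mul, norm_innerNormal, mul_one,
    Complex.norm_real, Real.norm_of_nonneg (by positivity)]
  linarith

/-- The test point `z + (s/2) n_j` lies in `halfPlane k z` iff `3 x_j x_k + y_j y_k > 0`.
[folklore] -/
theorem testPoint_mem_halfPlane_iff (z : ℂ) {s : ℝ} (hs : 0 < s) (j k : Fin 6) :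
    z + ((s / 2 : ℝ) : ℂ) * innerNormal j ∈ halfPlane k z ↔ 0 < 3 * (![0, 0, 1, -1, 1, -1] : Fin 6 → ℤ) j * (![0, 0, 1, -1, 1, -1] : Fin 6 → ℤ) k + (![2, -2, -1, 1, 1, -1] : Fin 6 → ℤ) j * (![2, -2, -1, 1, 1, -1] : Fin 6 → ℤ) k := by
  rw [mem_halfPlane_iff_level, add_sub_cancel_left, mul_assoc, Complex.re_ofReal_mul,
    re_mul_conj_innerNormal, mul_pos_iff_of_pos_left (by positivity : (0 : ℝ) < s / 2),
    div_pos_iff_of_pos_right (by norm_num : (0 : ℝ) < 4), Int.cast_pos]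

/-- Two sets with the same trace on `B(z, s)` contain the same test points. [folklore] -/
theorem testPoint_mem_iff_of_inter_ball_eq {A B : Set ℂ} {z : ℂ} {s : ℝ} (hs : 0 < s)
    (h : A ∩ ball z s = B ∩ ball z s) (j : Fin 6) :
    z + ((s / 2 : ℝ) : ℂ) * innerNormal j ∈ A ↔ z + ((s / 2 : ℝ) : ℂ) * innerNormal j ∈ B := by
  have hb := testPoint_mem_ball z hs j
  have := Set.ext_iff.1 h (z + ((s / 2 : ℝ) : ℂ) * innerNormal j)
  simpa only [mem_inter_iff, hb, and_true] using this

/-- Restricting a trace identity on `B(z, s)` to a subset of the ball. [folklore] -/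
theorem inter_eq_inter_of_subset_ball {A B S : Set ℂ} {z : ℂ} {s : ℝ}
    (h : A ∩ ball z s = B ∩ ball z s) (hS : S ⊆ ball z s) : A ∩ S = B ∩ S := by
  ext w
  constructor
  · rintro ⟨hw, hwS⟩
    have : w ∈ A ∩ ball z s := ⟨hw, hS hwS⟩
    rw [h] at this
    exact ⟨this.1, hwS⟩
  · rintro ⟨hw, hwS⟩
    have : w ∈ B ∩ ball z s := ⟨hw, hS hwS⟩
    rw [← h] at this
    exact ⟨this.1, hwS⟩

/-! ### 2. Normals: injectivity, opposite forms -/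

/-- **The six inner normals are pairwise distinct.** [folklore] -/
theorem innerNormal_injective {j k : Fin 6} (h : innerNormal j = innerNormal k) : j = k := by
  have key : ∀ j k : Fin 6, 3 * (![0, 0, 1, -1, 1, -1] : Fin 6 → ℤ) j * (![0, 0, 1, -1, 1, -1] : Fin 6 → ℤ) k + (![2, -2, -1, 1, 1, -1] : Fin 6 → ℤ) j * (![2, -2, -1, 1, 1, -1] : Fin 6 → ℤ) k = 4 → j = k := by decide
  refine key j k ?_
  have h1 := re_mul_conj_innerNormal j k
  rw [h, re_innerNormal_mul_conj] at h1
  exact_mod_cast (by linarith : ((3 * (![0, 0, 1, -1, 1, -1] : Fin 6 → ℤ) j * (![0, 0, 1, -1, 1, -1] : Fin 6 → ℤ) k + (![2, -2, -1, 1, 1, -1] : Fin 6 → ℤ) j * (![2, -2, -1, 1, 1, -1] : Fin 6 → ℤ) k : ℤ) : ℝ) = 4)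

/-- `n_{k'} = -n_k` exactly for the opposite form `k' = (1,0,3,2,5,4)_k`. [folklore] -/
theorem eq_opp_of_innerNormal_eq_neg {k k' : Fin 6} (h : innerNormal k' = -innerNormal k) :
    k' = (![1, 0, 3, 2, 5, 4] : Fin 6 → Fin 6) k := by
  have key : ∀ k k' : Fin 6, 3 * (![0, 0, 1, -1, 1, -1] : Fin 6 → ℤ) k' * (![0, 0, 1, -1, 1, -1] : Fin 6 → ℤ) k + (![2, -2, -1, 1, 1, -1] : Fin 6 → ℤ) k' * (![2, -2, -1, 1, 1, -1] : Fin 6 → ℤ) k = -4 →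
      k' = (![1, 0, 3, 2, 5, 4] : Fin 6 → Fin 6) k := by decide
  refine key k k' ?_
  have h1 := re_mul_conj_innerNormal k' k
  rw [h, neg_mul, Complex.neg_re, re_innerNormal_mul_conj] at h1
  exact_mod_cast (by linarith : ((3 * (![0, 0, 1, -1, 1, -1] : Fin 6 → ℤ) k' * (![0, 0, 1, -1, 1, -1] : Fin 6 → ℤ) k + (![2, -2, -1, 1, 1, -1] : Fin 6 → ℤ) k' * (![2, -2, -1, 1, 1, -1] : Fin 6 → ℤ) k : ℤ) : ℝ) = -4)

/-- The opposite form has the opposite normal. [folklore] -/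
theorem innerNormal_opp (k : Fin 6) :
    innerNormal ((![1, 0, 3, 2, 5, 4] : Fin 6 → Fin 6) k) = -innerNormal k := by
  fin_cases k <;> simp [innerNormal_eq]

/-- Half-planes only depend on the normal. [folklore] -/
theorem halfPlane_congr {k k' : Fin 6} (h : innerNormal k' = innerNormal k) (c : ℂ) :
    halfPlane k' c = halfPlane k c := by
  ext w
  rw [mem_halfPlane_iff_level, mem_halfPlane_iff_level, h]

/-- The half-plane of the opposite normal is the open negative side. [folklore] -/
theorem halfPlane_of_innerNormal_eq_neg {k k' : Fin 6} (h : innerNormal k' = -innerNormal k)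
    (c : ℂ) : halfPlane k' c = {w : ℂ | ((w - c) * conj (innerNormal k)).re < 0} := by
  ext w
  rw [mem_halfPlane_iff_level, h, map_neg, mul_neg, Complex.neg_re, mem_setOf_eq, neg_pos]

/-! ### 3. Forms are determined by the local set -/

/-- **The form of a flat ball is unique**: `halfPlane k₁ z ∩ B(z,s) = halfPlane k₂ z ∩ B(z,s)`
with `s > 0` forces `k₁ = k₂` (test the six points `z + (s/2) n_j`). [folklore] -/
theorem form_unique {z : ℂ} {s : ℝ} (hs : 0 < s) {k₁ k₂ : Fin 6}
    (h : halfPlane k₁ z ∩ ball z s = halfPlane k₂ z ∩ ball z s) : k₁ = k₂ := by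
  have key : ∀ k₁ k₂ : Fin 6, (∀ j : Fin 6, (0 < 3 * (![0, 0, 1, -1, 1, -1] : Fin 6 → ℤ) j * (![0, 0, 1, -1, 1, -1] : Fin 6 → ℤ) k₁ + (![2, -2, -1, 1, 1, -1] : Fin 6 → ℤ) j * (![2, -2, -1, 1, 1, -1] : Fin 6 → ℤ) k₁ ↔
      0 < 3 * (![0, 0, 1, -1, 1, -1] : Fin 6 → ℤ) j * (![0, 0, 1, -1, 1, -1] : Fin 6 → ℤ) k₂ + (![2, -2, -1, 1, 1, -1] : Fin 6 → ℤ) j * (![2, -2, -1, 1, 1, -1] : Fin 6 → ℤ) k₂)) → k₁ = k₂ := by decide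
  refine key k₁ k₂ fun j => ?_
  rw [← testPoint_mem_halfPlane_iff z hs j k₁, ← testPoint_mem_halfPlane_iff z hs j k₂]
  exact testPoint_mem_iff_of_inter_ball_eq hs h j

/-- Test-point signature of a convex corner presentation. [folklore] -/
theorem testPoint_mem_iff_of_inter {X : Set ℂ} {z : ℂ} {s : ℝ} (hs : 0 < s) {k k' : Fin 6}
    (h : X = halfPlane k z ∩ halfPlane k' z ∩ ball z s) (j : Fin 6) :
    z + ((s / 2 : ℝ) : ℂ) * innerNormal j ∈ X ↔
      (0 < 3 * (![0, 0, 1, -1, 1, -1] : Fin 6 → ℤ) j * (![0, 0, 1, -1, 1, -1] : Fin 6 → ℤ) k + (![2, -2, -1, 1, 1, -1] : Fin 6 → ℤ) j * (![2, -2, -1, 1, 1, -1] : Fin 6 → ℤ) k ∧ 0 < 3 * (![0, 0, 1, -1, 1, -1] : Fin 6 → ℤ) j * (![0, 0, 1, -1, 1, -1] : Fin 6 → ℤ) k' + (![2, -2, -1, 1, 1, -1] : Fin 6 → ℤ) j * (![2, -2, -1, 1, 1, -1] : Fin 6 → ℤ) k') := by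
  rw [h, mem_inter_iff, mem_inter_iff, testPoint_mem_halfPlane_iff z hs,
    testPoint_mem_halfPlane_iff z hs]
  simp only [testPoint_mem_ball z hs j, and_true]

/-- Test-point signature of a reflex corner presentation. [folklore] -/
theorem testPoint_mem_iff_of_union {X : Set ℂ} {z : ℂ} {s : ℝ} (hs : 0 < s) {k k' : Fin 6}
    (h : X = (halfPlane k z ∪ halfPlane k' z) ∩ ball z s) (j : Fin 6) :
    z + ((s / 2 : ℝ) : ℂ) * innerNormal j ∈ X ↔
      (0 < 3 * (![0, 0, 1, -1, 1, -1] : Fin 6 → ℤ) j * (![0, 0, 1, -1, 1, -1] : Fin 6 → ℤ) k + (![2, -2, -1, 1, 1, -1] : Fin 6 → ℤ) j * (![2, -2, -1, 1, 1, -1] : Fin 6 → ℤ) k ∨ 0 < 3 * (![0, 0, 1, -1, 1, -1] : Fin 6 → ℤ) j * (![0, 0, 1, -1, 1, -1] : Fin 6 → ℤ) k' + (![2, -2, -1, 1, 1, -1] : Fin 6 → ℤ) j * (![2, -2, -1, 1, 1, -1] : Fin 6 → ℤ) k') := by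
  rw [h, mem_inter_iff, mem_union, testPoint_mem_halfPlane_iff z hs,
    testPoint_mem_halfPlane_iff z hs]
  simp only [testPoint_mem_ball z hs j, and_true]

/-- Test-point signature of a flat presentation. [folklore] -/
theorem testPoint_mem_iff_of_flat {X : Set ℂ} {z : ℂ} {s : ℝ} (hs : 0 < s) {k : Fin 6}
    (h : X = halfPlane k z ∩ ball z s) (j : Fin 6) :
    z + ((s / 2 : ℝ) : ℂ) * innerNormal j ∈ X ↔ 0 < 3 * (![0, 0, 1, -1, 1, -1] : Fin 6 → ℤ) j * (![0, 0, 1, -1, 1, -1] : Fin 6 → ℤ) k + (![2, -2, -1, 1, 1, -1] : Fin 6 → ℤ) j * (![2, -2, -1, 1, 1, -1] : Fin 6 → ℤ) k := by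
  rw [h, mem_inter_iff, testPoint_mem_halfPlane_iff z hs]
  simp only [testPoint_mem_ball z hs j, and_true]

set_option maxRecDepth 4000 in
/-- **The forms of a genuine corner ball are unique**: two corner presentations (convex or reflex,
in any combination) of the same set on `B(z, s)`, the first one genuine (`n_{k'} ≠ ± n_k`), have
the same unordered pair of forms. [folklore] -/
theorem corner_forms_unique {X : Set ℂ} {z : ℂ} {s : ℝ} (hs : 0 < s) {k k' k₂ k₂' : Fin 6}
    (hk : innerNormal k' ≠ innerNormal k) (hk' : innerNormal k' ≠ -innerNormal k)
    (h₁ : X = halfPlane k z ∩ halfPlane k' z ∩ ball z s ∨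
      X = (halfPlane k z ∪ halfPlane k' z) ∩ ball z s)
    (h₂ : X = halfPlane k₂ z ∩ halfPlane k₂' z ∩ ball z s ∨
      X = (halfPlane k₂ z ∪ halfPlane k₂' z) ∩ ball z s) :
    (k₂ = k ∧ k₂' = k') ∨ (k₂ = k' ∧ k₂' = k) := by
  have hk1 : k' ≠ k := fun h => hk (by rw [h])
  have hk2 : k' ≠ (![1, 0, 3, 2, 5, 4] : Fin 6 → Fin 6) k := fun h => hk' (by rw [h, innerNormal_opp])
  have keyII : ∀ k k' k₂ k₂' : Fin 6, k' ≠ k → k' ≠ (![1, 0, 3, 2, 5, 4] : Fin 6 → Fin 6) k →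
      (∀ j : Fin 6, ((0 < 3 * (![0, 0, 1, -1, 1, -1] : Fin 6 → ℤ) j * (![0, 0, 1, -1, 1, -1] : Fin 6 → ℤ) k + (![2, -2, -1, 1, 1, -1] : Fin 6 → ℤ) j * (![2, -2, -1, 1, 1, -1] : Fin 6 → ℤ) k ∧ 0 < 3 * (![0, 0, 1, -1, 1, -1] : Fin 6 → ℤ) j * (![0, 0, 1, -1, 1, -1] : Fin 6 → ℤ) k' + (![2, -2, -1, 1, 1, -1] : Fin 6 → ℤ) j * (![2, -2, -1, 1, 1, -1] : Fin 6 → ℤ) k') ↔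
        (0 < 3 * (![0, 0, 1, -1, 1, -1] : Fin 6 → ℤ) j * (![0, 0, 1, -1, 1, -1] : Fin 6 → ℤ) k₂ + (![2, -2, -1, 1, 1, -1] : Fin 6 → ℤ) j * (![2, -2, -1, 1, 1, -1] : Fin 6 → ℤ) k₂ ∧ 0 < 3 * (![0, 0, 1, -1, 1, -1] : Fin 6 → ℤ) j * (![0, 0, 1, -1, 1, -1] : Fin 6 → ℤ) k₂' + (![2, -2, -1, 1, 1, -1] : Fin 6 → ℤ) j * (![2, -2, -1, 1, 1, -1] : Fin 6 → ℤ) k₂'))) →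
      (k₂ = k ∧ k₂' = k') ∨ (k₂ = k' ∧ k₂' = k) := by decide
  have keyIU : ∀ k k' k₂ k₂' : Fin 6, k' ≠ k → k' ≠ (![1, 0, 3, 2, 5, 4] : Fin 6 → Fin 6) k →
      (∀ j : Fin 6, ((0 < 3 * (![0, 0, 1, -1, 1, -1] : Fin 6 → ℤ) j * (![0, 0, 1, -1, 1, -1] : Fin 6 → ℤ) k + (![2, -2, -1, 1, 1, -1] : Fin 6 → ℤ) j * (![2, -2, -1, 1, 1, -1] : Fin 6 → ℤ) k ∧ 0 < 3 * (![0, 0, 1, -1, 1, -1] : Fin 6 → ℤ) j * (![0, 0, 1, -1, 1, -1] : Fin 6 → ℤ) k' + (![2, -2, -1, 1, 1, -1] : Fin 6 → ℤ) j * (![2, -2, -1, 1, 1, -1] : Fin 6 → ℤ) k') ↔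
        (0 < 3 * (![0, 0, 1, -1, 1, -1] : Fin 6 → ℤ) j * (![0, 0, 1, -1, 1, -1] : Fin 6 → ℤ) k₂ + (![2, -2, -1, 1, 1, -1] : Fin 6 → ℤ) j * (![2, -2, -1, 1, 1, -1] : Fin 6 → ℤ) k₂ ∨ 0 < 3 * (![0, 0, 1, -1, 1, -1] : Fin 6 → ℤ) j * (![0, 0, 1, -1, 1, -1] : Fin 6 → ℤ) k₂' + (![2, -2, -1, 1, 1, -1] : Fin 6 → ℤ) j * (![2, -2, -1, 1, 1, -1] : Fin 6 → ℤ) k₂'))) →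
      (k₂ = k ∧ k₂' = k') ∨ (k₂ = k' ∧ k₂' = k) := by decide
  have keyUI : ∀ k k' k₂ k₂' : Fin 6, k' ≠ k → k' ≠ (![1, 0, 3, 2, 5, 4] : Fin 6 → Fin 6) k →
      (∀ j : Fin 6, ((0 < 3 * (![0, 0, 1, -1, 1, -1] : Fin 6 → ℤ) j * (![0, 0, 1, -1, 1, -1] : Fin 6 → ℤ) k + (![2, -2, -1, 1, 1, -1] : Fin 6 → ℤ) j * (![2, -2, -1, 1, 1, -1] : Fin 6 → ℤ) k ∨ 0 < 3 * (![0, 0, 1, -1, 1, -1] : Fin 6 → ℤ) j * (![0, 0, 1, -1, 1, -1] : Fin 6 → ℤ) k' + (![2, -2, -1, 1, 1, -1] : Fin 6 → ℤ) j * (![2, -2, -1, 1, 1, -1] : Fin 6 → ℤ) k') ↔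
        (0 < 3 * (![0, 0, 1, -1, 1, -1] : Fin 6 → ℤ) j * (![0, 0, 1, -1, 1, -1] : Fin 6 → ℤ) k₂ + (![2, -2, -1, 1, 1, -1] : Fin 6 → ℤ) j * (![2, -2, -1, 1, 1, -1] : Fin 6 → ℤ) k₂ ∧ 0 < 3 * (![0, 0, 1, -1, 1, -1] : Fin 6 → ℤ) j * (![0, 0, 1, -1, 1, -1] : Fin 6 → ℤ) k₂' + (![2, -2, -1, 1, 1, -1] : Fin 6 → ℤ) j * (![2, -2, -1, 1, 1, -1] : Fin 6 → ℤ) k₂'))) →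
      (k₂ = k ∧ k₂' = k') ∨ (k₂ = k' ∧ k₂' = k) := by decide
  have keyUU : ∀ k k' k₂ k₂' : Fin 6, k' ≠ k → k' ≠ (![1, 0, 3, 2, 5, 4] : Fin 6 → Fin 6) k →
      (∀ j : Fin 6, ((0 < 3 * (![0, 0, 1, -1, 1, -1] : Fin 6 → ℤ) j * (![0, 0, 1, -1, 1, -1] : Fin 6 → ℤ) k + (![2, -2, -1, 1, 1, -1] : Fin 6 → ℤ) j * (![2, -2, -1, 1, 1, -1] : Fin 6 → ℤ) k ∨ 0 < 3 * (![0, 0, 1, -1, 1, -1] : Fin 6 → ℤ) j * (![0, 0, 1, -1, 1, -1] : Fin 6 → ℤ) k' + (![2, -2, -1, 1, 1, -1] : Fin 6 → ℤ) j * (![2, -2, -1, 1, 1, -1] : Fin 6 → ℤ) k') ↔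
        (0 < 3 * (![0, 0, 1, -1, 1, -1] : Fin 6 → ℤ) j * (![0, 0, 1, -1, 1, -1] : Fin 6 → ℤ) k₂ + (![2, -2, -1, 1, 1, -1] : Fin 6 → ℤ) j * (![2, -2, -1, 1, 1, -1] : Fin 6 → ℤ) k₂ ∨ 0 < 3 * (![0, 0, 1, -1, 1, -1] : Fin 6 → ℤ) j * (![0, 0, 1, -1, 1, -1] : Fin 6 → ℤ) k₂' + (![2, -2, -1, 1, 1, -1] : Fin 6 → ℤ) j * (![2, -2, -1, 1, 1, -1] : Fin 6 → ℤ) k₂'))) →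
      (k₂ = k ∧ k₂' = k') ∨ (k₂ = k' ∧ k₂' = k) := by decide
  rcases h₁ with h₁ | h₁ <;> rcases h₂ with h₂ | h₂
  · exact keyII k k' k₂ k₂' hk1 hk2 fun j => by
      rw [← testPoint_mem_iff_of_inter hs h₁ j, ← testPoint_mem_iff_of_inter hs h₂ j]
  · exact keyIU k k' k₂ k₂' hk1 hk2 fun j => by
      rw [← testPoint_mem_iff_of_inter hs h₁ j, ← testPoint_mem_iff_of_union hs h₂ j]
  · exact keyUI k k' k₂ k₂' hk1 hk2 fun j => by
      rw [← testPoint_mem_iff_of_union hs h₁ j, ← testPoint_mem_iff_of_inter hs h₂ j]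
  · exact keyUU k k' k₂ k₂' hk1 hk2 fun j => by
      rw [← testPoint_mem_iff_of_union hs h₁ j, ← testPoint_mem_iff_of_union hs h₂ j]

/-- **A flat ball has only trivial corner presentations**: if `X = halfPlane k₀ z ∩ B(z, s)` is
also presented as a convex or reflex corner of forms `k₂, k₂'`, then `k₂ = k₂' = k₀`.
[folklore] -/
theorem corner_forms_of_flat {X : Set ℂ} {z : ℂ} {s : ℝ} (hs : 0 < s) {k₀ k₂ k₂' : Fin 6}
    (h₁ : X = halfPlane k₀ z ∩ ball z s)
    (h₂ : X = halfPlane k₂ z ∩ halfPlane k₂' z ∩ ball z s ∨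
      X = (halfPlane k₂ z ∪ halfPlane k₂' z) ∩ ball z s) : k₂ = k₀ ∧ k₂' = k₀ := by
  have keyI : ∀ k₀ k₂ k₂' : Fin 6,
      (∀ j : Fin 6, (0 < 3 * (![0, 0, 1, -1, 1, -1] : Fin 6 → ℤ) j * (![0, 0, 1, -1, 1, -1] : Fin 6 → ℤ) k₀ + (![2, -2, -1, 1, 1, -1] : Fin 6 → ℤ) j * (![2, -2, -1, 1, 1, -1] : Fin 6 → ℤ) k₀ ↔
        (0 < 3 * (![0, 0, 1, -1, 1, -1] : Fin 6 → ℤ) j * (![0, 0, 1, -1, 1, -1] : Fin 6 → ℤ) k₂ + (![2, -2, -1, 1, 1, -1] : Fin 6 → ℤ) j * (![2, -2, -1, 1, 1, -1] : Fin 6 → ℤ) k₂ ∧ 0 < 3 * (![0, 0, 1, -1, 1, -1] : Fin 6 → ℤ) j * (![0, 0, 1, -1, 1, -1] : Fin 6 → ℤ) k₂' + (![2, -2, -1, 1, 1, -1] : Fin 6 → ℤ) j * (![2, -2, -1, 1, 1, -1] : Fin 6 → ℤ) k₂'))) →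
      k₂ = k₀ ∧ k₂' = k₀ := by decide
  have keyU : ∀ k₀ k₂ k₂' : Fin 6,
      (∀ j : Fin 6, (0 < 3 * (![0, 0, 1, -1, 1, -1] : Fin 6 → ℤ) j * (![0, 0, 1, -1, 1, -1] : Fin 6 → ℤ) k₀ + (![2, -2, -1, 1, 1, -1] : Fin 6 → ℤ) j * (![2, -2, -1, 1, 1, -1] : Fin 6 → ℤ) k₀ ↔
        (0 < 3 * (![0, 0, 1, -1, 1, -1] : Fin 6 → ℤ) j * (![0, 0, 1, -1, 1, -1] : Fin 6 → ℤ) k₂ + (![2, -2, -1, 1, 1, -1] : Fin 6 → ℤ) j * (![2, -2, -1, 1, 1, -1] : Fin 6 → ℤ) k₂ ∨ 0 < 3 * (![0, 0, 1, -1, 1, -1] : Fin 6 → ℤ) j * (![0, 0, 1, -1, 1, -1] : Fin 6 → ℤ) k₂' + (![2, -2, -1, 1, 1, -1] : Fin 6 → ℤ) j * (![2, -2, -1, 1, 1, -1] : Fin 6 → ℤ) k₂'))) →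
      k₂ = k₀ ∧ k₂' = k₀ := by decide
  rcases h₂ with h₂ | h₂
  · exact keyI k₀ k₂ k₂' fun j => by
      rw [← testPoint_mem_iff_of_flat hs h₁ j, ← testPoint_mem_iff_of_inter hs h₂ j]
  · exact keyU k₀ k₂ k₂' fun j => by
      rw [← testPoint_mem_iff_of_flat hs h₁ j, ← testPoint_mem_iff_of_union hs h₂ j]

/-- **A genuine corner ball is not flat.** [folklore] -/
theorem not_flat_of_corner {X : Set ℂ} {z : ℂ} {s : ℝ} (hs : 0 < s) {k₀ k k' : Fin 6}
    (hk : innerNormal k' ≠ innerNormal k)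
    (h₁ : X = halfPlane k₀ z ∩ ball z s)
    (h₂ : X = halfPlane k z ∩ halfPlane k' z ∩ ball z s ∨
      X = (halfPlane k z ∪ halfPlane k' z) ∩ ball z s) : False := by
  obtain ⟨h1, h2⟩ := corner_forms_of_flat hs h₁ h₂
  exact hk (by rw [h1, h2])

/-- For non-opposite forms there is a test direction inside both half-planes. [folklore] -/
theorem exists_testPoint_mem_inter {k k' : Fin 6} (hk' : innerNormal k' ≠ -innerNormal k)
    (z : ℂ) {s : ℝ} (hs : 0 < s) :
    ∃ j : Fin 6, z + ((s / 2 : ℝ) : ℂ) * innerNormal j ∈ halfPlane k z ∩ halfPlane k' z ∩ ball z s := by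
  have hk2 : k' ≠ (![1, 0, 3, 2, 5, 4] : Fin 6 → Fin 6) k := fun h => hk' (by rw [h, innerNormal_opp])
  have key : ∀ k k' : Fin 6, k' ≠ (![1, 0, 3, 2, 5, 4] : Fin 6 → Fin 6) k →
      ∃ j : Fin 6, 0 < 3 * (![0, 0, 1, -1, 1, -1] : Fin 6 → ℤ) j * (![0, 0, 1, -1, 1, -1] : Fin 6 → ℤ) k + (![2, -2, -1, 1, 1, -1] : Fin 6 → ℤ) j * (![2, -2, -1, 1, 1, -1] : Fin 6 → ℤ) k ∧ 0 < 3 * (![0, 0, 1, -1, 1, -1] : Fin 6 → ℤ) j * (![0, 0, 1, -1, 1, -1] : Fin 6 → ℤ) k' + (![2, -2, -1, 1, 1, -1] : Fin 6 → ℤ) j * (![2, -2, -1, 1, 1, -1] : Fin 6 → ℤ) k' := by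
    decide
  obtain ⟨j, hj, hj'⟩ := key k k' hk2
  exact ⟨j, ⟨(testPoint_mem_halfPlane_iff z hs j k).2 hj, (testPoint_mem_halfPlane_iff z hs j k').2 hj'⟩,
    testPoint_mem_ball z hs j⟩

/-! ### 4. Flat balls -/

/-- The half-planes of form `k` through two points of the same side line coincide. [folklore] -/
theorem halfPlane_eq_of_level_eq_zero {k : Fin 6} {z q : ℂ}
    (h : ((q - z) * conj (innerNormal k)).re = 0) : halfPlane k q = halfPlane k z := by
  ext w
  rw [mem_halfPlane_iff_level, mem_halfPlane_iff_level]
  have : (w - z) * conj (innerNormal k) =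
      (w - q) * conj (innerNormal k) + (q - z) * conj (innerNormal k) := by ring
  rw [this, Complex.add_re, h, add_zero]

/-- **Frontier points of a flat ball lie on the side line.** [folklore] -/
theorem level_eq_zero_of_mem_frontier {U : Set ℂ} (hU : IsOpen U) {k : Fin 6} {z : ℂ} {s : ℝ}
    (hflat : U ∩ ball z s = halfPlane k z ∩ ball z s) {q : ℂ} (hq : q ∈ frontier U)
    (hqs : q ∈ ball z s) : ((q - z) * conj (innerNormal k)).re = 0 := by
  rw [frontier, hU.interior_eq] at hq
  obtain ⟨hqc, hqU⟩ := hq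
  apply le_antisymm
  · by_contra hpos
    push Not at hpos
    have : q ∈ halfPlane k z ∩ ball z s := ⟨hpos, hqs⟩
    rw [← hflat] at this
    exact hqU this.1
  · have h1 : q ∈ closure (U ∩ ball z s) := by
      rw [inter_comm]
      exact isOpen_ball.inter_closure ⟨hqs, hqc⟩
    rw [hflat] at h1
    have hcont : Continuous fun w : ℂ => ((w - z) * conj (innerNormal k)).re := by fun_prop
    have h2 : closure (halfPlane k z ∩ ball z s) ⊆ {w : ℂ | 0 ≤ ((w - z) * conj (innerNormal k)).re} :=
      (closure_mono inter_subset_left).trans (closure_lt_subset_le continuous_const hcont)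
    exact h2 h1

/-- **Side-line points of a flat ball are frontier points** (approach along the normal).
[folklore] -/
theorem mem_frontier_of_level_eq_zero {U : Set ℂ} (hU : IsOpen U) {k : Fin 6} {z : ℂ} {s : ℝ}
    (hflat : U ∩ ball z s = halfPlane k z ∩ ball z s) {q : ℂ} (hqs : q ∈ ball z s)
    (hq : ((q - z) * conj (innerNormal k)).re = 0) : q ∈ frontier U := by
  rw [frontier, hU.interior_eq]
  refine ⟨?_, fun hqU => ?_⟩
  · have hray := PickHalfPlane.Identification.tendsto_ray q (innerNormal k)
    refine mem_closure_of_tendsto hray ?_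
    filter_upwards [hray (isOpen_ball.mem_nhds hqs), self_mem_nhdsWithin] with t ht ht0
    have ht0' : (0 : ℝ) < t := ht0
    have hmem : q + (t : ℂ) * innerNormal k ∈ halfPlane k z ∩ ball z s := by
      refine ⟨?_, ht⟩
      rw [mem_halfPlane_iff_level]
      have : (q + (t : ℂ) * innerNormal k - z) * conj (innerNormal k) =
          (q - z) * conj (innerNormal k) + (t : ℂ) * (innerNormal k * conj (innerNormal k)) := by ring
      rw [this, Complex.add_re, hq, zero_add, Complex.re_ofReal_mul, re_innerNormal_mul_conj, mul_one]
      exact ht0'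
    rw [← hflat] at hmem
    exact hmem.1
  · have : q ∈ U ∩ ball z s := ⟨hqU, hqs⟩
    rw [hflat] at this
    have h := (mem_halfPlane_iff_level k z q).1 this.1
    rw [hq] at h
    exact lt_irrefl _ h

/-- **Sub-balls of a flat ball about side-line points are flat with the same form.** [folklore] -/
theorem flat_of_subset {U : Set ℂ} {k : Fin 6} {z q : ℂ} {s t : ℝ}
    (hflat : U ∩ ball z s = halfPlane k z ∩ ball z s) (hsub : ball q t ⊆ ball z s)
    (hq : ((q - z) * conj (innerNormal k)).re = 0) : U ∩ ball q t = halfPlane k q ∩ ball q t := by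
  rw [halfPlane_eq_of_level_eq_zero hq]
  exact inter_eq_inter_of_subset_ball hflat hsub

/-! ### Registered form -/

/-- **Registered helper `phaseBookkeeping_formUnique`** (∀-closed form of `form_unique`; sub-goal
of stub `boundaryPhaseBookkeeping`, crux stmt-CriticalPhenomena-14004, line
`polygon-parity-squeeze`): the form of a flat zigzag ball is determined by the set. [folklore] -/
theorem phaseBookkeeping_formUnique : ∀ (z : ℂ) (s : ℝ) (k₁ k₂ : Fin 6), 0 < s → halfPlane k₁ z ∩ Metric.ball z s = halfPlane k₂ z ∩ Metric.ball z s → k₁ = k₂ :=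
  fun _ _ _ _ hs h => form_unique hs h

end PhaseGeometry

end Summit.CriticalPhenomena.SAWScalingLimit.Theorems.PolygonParitySqueeze

end
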